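import Summits.AtomisticToContinuum.FouriersLaw.Theses.BondHeatUncertainty
import Summits.AtomisticToContinuum.FouriersLaw.Theorems.BondHeatUncertaintyLinearResponseFTUR
import Summits.AtomisticToContinuum.FouriersLaw.Theorems.EmbeddedDrudeMourreNessUnique

/-!
# `BoundedResponse` ⟸ transient contact budget at the Thouless time («TransientContactBudget»)

Route `AtomisticToContinuum/FouriersLaw/BondHeatUncertainty`, shared waypoint `BoundedResponse`
(stmt-11071: `sup_N |D_N| < ∞` along every steady-state family).  The route of record reaches it
by `TransferToBoundedResponse` from `(S)` `SubdiffusiveBondHeat` (stmt-9120), `(K)`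
`ExtensiveSnapshotIrreversibility` (stmt-9121, the extensive snapshot KL of the STEADY state) and
the stationary uncertainty relation `(★)` `LinearResponseFTUR` (stmt-9122, PROVED).  This file
types a second transfer in which `(K)` — its fixed-`N` NESS-density half (`K_fix`, `USharp`, atoms
A2–A4) as well as its `N`-uniform half — does NOT occur.

## Mechanism (Gibbs-started transient at linear order; no steady-state density anywhere)

Start the dynamics with baths `T ± δ/2` from the Gibbs measure `μ_T` and run it for a time `τ`.
For every path functional `Q` that is ODD under flip-composed time reversal `Θ~` (the heat `Q_b`
through a bond, the contact heat `Q_L^in`, an increment `E(x_τ) - E(x_0)`), the path-space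
fluctuation relation `dP^δ/dΘ~_*P^δ = exp R`, `R = (δ/T²)·Q^avg + O(δ²)`,
`Q^avg := ½(Q_L^in + Q_R^out)`, gives at first order

  `lim_{δ→0} E^δ_{μ_T}[Q]/δ = Cov_eq(Q, Q^avg)/(2T²)`.                                 (FR)

(At linear order from equilibrium, raising a bath temperature and anti-damping the same contact
have the same source `∝ p² - T`, so (FR) is drift-Girsanov plus `Θ~`-invariance of the
equilibrium path law — the technology landed for `(★)`: `stub_antiDampedGirsanov`,
`stub_pathLebesgueDuality`, `stub_bondHeatVarianceContinuity`.)  Energy balance splits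
`Q_L^in = Q_b + ΔE_{≤b}` and `Q^avg = Q_b + ½(ΔE_{≤b} - ΔE_{>b})` pathwise, so Cauchy–Schwarz
under the EQUILIBRIUM path law bounds the linear-order injected heat
`q_L(τ) := lim E^δ[Q_L^in([0,τ])]/δ` by the equilibrium bond-heat variance `V = V_N(b,τ)` of `(S)`
and the STATIC Gibbs variances `W_L, W_R` of the two block energies:

  `q_L(τ) ≤ (V + √(2V(W_L+W_R)))/(2T²) + √(W_L(2V + 4(W_L+W_R)))/T²`.        (K_T, fixed N)

`q_L` has the closed form `q_L(τ) = τγ/2 - T²∫_0^τ (τ-u) C^g_N(u) du` (Duhamel + reflection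
symmetry), `C^g_N(u) = ⟨g, P_u g⟩_{μ_T}`, `g = (γ/2T²)(p_0² - p_{N-1}²)` the boundary kinetic
imbalance — its DEFINITION below (`contactHeatResponse`) — and the steady current is its slope at
`τ = ∞`: `G_N = D_N/(N-1) = γ/2 - T²∫_0^∞ C^g_N`.  The one `N`-uniform dynamical input is

  `c N² · G_N ≤ q_L(cN²) + C·N`                                               (P, N-uniform),

"up to the Thouless time the hot contact injects, at linear order, at least the steady throughput
minus `O(N)δ`" (`∫_0^τ (J_L(s) - J_δ) ds ≥ -CNδ`; in the diffusive continuum the surplus is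
`+c_v N δ/12 > 0` and `J_L ≥ J_δ` pointwise).  With `(S)` at `t = cN²` (`V ≤ A√c·N`) and
`W ≤ C_W N`, (K_T) gives `q_L(cN²) = O(N)`, (P) gives `G_N = O(1/N)`, i.e. `D_N = O(1)`; the lower
bound `0 ≤ D_N` is clause (a) of the PROVED `(★)`.  At linear order the transient uncertainty
relation IS Cauchy–Schwarz: no KL divergence and no steady-state density enter.

## Items (typed `Prop`s) and junction

`TransientContactBudgetFixedN` (K_T, WEAKER·ATTACKABLE: fixed `N`, finite time, equilibrium
objects only), `ExtensiveBlockEnergyVariance` (W, WEAKER·ATTACKABLE: Gibbs statics, Brascamp–Lieb),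
`TransientContactSurplus` (P, UNDECIDED·INSTRUMENTABLE: one-sided first-moment linear response,
implied by `BoundedResponse` itself since `q_L ≥ 0`); junction
`boundedResponse_of_transientContact : K_T → W → P → SubdiffusiveBondHeat → LinearResponseFTUR →
NessUnique → BoundedResponse` (kernel-checked real arithmetic, no new axioms; of `(★)` only
`0 ≤ D_N` is used) and the primed form with the two PROVED items discharged
(`LinearResponseFTUR_proof`, `nessUnique_proof`).

Sources: HasegawaVanVu2019 (arXiv:1902.06376, transient FTUR from an arbitrary initial state);
BonettoLebowitzReyBellet2000 §5–6; KunduDharNarayan2009 (open-chain Green–Kubo); the remark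
"a transient-FTUR variant of (★) would make this crux nearly free" in the tree note
`Cruxes/ExtensiveSnapshotIrreversibility/Ideas/window-jensen-bond-heat.md` (untyped; no energy
balance, no isolation of (P)) is the nearest prior note.
-/

namespace Summit.AtomisticToContinuum.FouriersLaw.Theorems.BoundedResponse.TransientContact

open MeasureTheory ProbabilityTheory Filter Set
open Literature.MathematicalPhysics.KineticTheory.HeatConduction
open Summit.AtomisticToContinuum.FouriersLaw.Theses.BondHeatUncertainty

noncomputable section

/-! ### Equilibrium objects -/

/-- The boundary kinetic-energy imbalance `g(q,p) = (γ/(2T²))·(p_0² − p_{N−1}²)` — the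
linear-order source `∂_δ L_δ^† 1` of the bias `T_L = T + δ/2`, `T_R = T − δ/2` in `L²(μ_T)`
(Gaussian integration by parts: `(γ/2)(∂²_{p_0} − ∂²_{p_{N−1}})^† 1 = g`); `0` for `N ≤ 1`.
[folklore] -/
def contactImbalance (P : OscillatorChain) (T : ℝ) (N : ℕ) (x : PhaseSpace N) : ℝ :=
  P.γ / (2 * T ^ 2) *
    ∑ i : Fin N, ((if i.val = 0 then x.2 i ^ 2 else 0) - (if i.val = N - 1 then x.2 i ^ 2 else 0))

/-- The equilibrium autocorrelation `C^g_N(u) = ∫ g · (P_u g) dμ_T` of the boundary imbalance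
(constructed `transitionKernel` at equal bath temperatures `T`, `gibbsMeasure`), the same currency
as the bond-current autocorrelation of `(S)`. [folklore] -/
def contactImbalanceCorr (P : OscillatorChain) (T : ℝ) (N : ℕ) (u : ℝ) : ℝ :=
  ∫ z, contactImbalance P T N z *
      (∫ y, contactImbalance P T N y ∂(P.transitionKernel N T T u.toNNReal z))
    ∂(P.gibbsMeasure N T)

/-- The **linear-order transient contact heat** `q_L^N(τ) := τγ/2 − T² ∫_0^τ (τ − u) C^g_N(u) du`:
the `δ`-derivative at `δ = 0` of the mean heat injected by the hot bath during `[0, τ]` into the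
chain started from `μ_T` (Duhamel at first order plus reflection symmetry
`⟨g, P_u g_L⟩ = ½C^g_N(u)`); `q_L(τ) = τγ/2 − (T²/2)·Var_eq(∫_0^τ g(x_s) ds)`, slope `γ/2` at
`τ = 0` (contact-limited injection)
and `G_N = γ/2 − T²∫_0^∞ C^g_N` at `τ = ∞` (Green–Kubo through the boundary source). [folklore] -/
def contactHeatResponse (P : OscillatorChain) (T : ℝ) (N : ℕ) (τ : ℝ) : ℝ :=
  τ * P.γ / 2 - T ^ 2 * ∫ u in (0 : ℝ)..τ, (τ - u) * contactImbalanceCorr P T N u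

/-- The equilibrium bond-current autocorrelation `C_N(b,s) = ∫ j_b · (P_s j_b) dμ_T` — VERBATIM the
`let C` of `SubdiffusiveBondHeat` / `LinearResponseFTUR` (`0` if `b ≥ N`). [folklore] -/
def gibbsBondCorr (P : OscillatorChain) (T : ℝ) (N b : ℕ) (s : ℝ) : ℝ :=
  if h : b < N then
    ∫ z, P.bondCurrent N ⟨b, h⟩ z *
        (∫ y, P.bondCurrent N ⟨b, h⟩ y ∂(P.transitionKernel N T T s.toNNReal z))
      ∂(P.gibbsMeasure N T)
  else 0

/-- The equilibrium bond-heat variance `V_N(b,t) = 2∫_0^t (t − s) C_N(b,s) ds` — VERBATIM the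
`let V` of `SubdiffusiveBondHeat` (definitionally, see `boundedResponse_of_transientContact`).
[folklore] -/
def gibbsBondHeatVar (P : OscillatorChain) (T : ℝ) (N b : ℕ) (t : ℝ) : ℝ :=
  2 * ∫ s in (0 : ℝ)..t, (t - s) * gibbsBondCorr P T N b s

/-- The energy `E_{≤b}` LEFT of the bond `(b, b+1)`: sites `0..b` with their pinning terms, the
bonds inside the block, and HALF of the bond `(b, b+1)` (the symmetric site-energy split under which
`d E_{≤b} = đQ_L^in − j_b dt` with the tree's `bondCurrent`). [Bonetto–Lebowitz–Rey-Bellet 2000,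
§5.2 eq. (23)] -/
def blockEnergyLeft (P : OscillatorChain) (N b : ℕ) (x : PhaseSpace N) : ℝ :=
  (∑ i : Fin N, if i.val ≤ b then x.2 i ^ 2 / 2 + P.U (x.1 i) else 0) +
    ∑ i : Fin N, ∑ j : Fin N,
      if j.val = i.val + 1 then
        (if j.val ≤ b then P.V (x.1 j - x.1 i)
          else if i.val = b then P.V (x.1 j - x.1 i) / 2 else 0)
      else 0

/-- The energy RIGHT of the bond `(b, b+1)`: `H − E_{≤b}`. [folklore] -/
def blockEnergyRight (P : OscillatorChain) (N b : ℕ) (x : PhaseSpace N) : ℝ :=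
  P.hamiltonian N x - blockEnergyLeft P N b x

/-- Static Gibbs variance `W_L = Var_{μ_T}(E_{≤b})` (Mathlib `ProbabilityTheory.variance`).
[folklore] -/
def blockEnergyLeftVar (P : OscillatorChain) (T : ℝ) (N b : ℕ) : ℝ :=
  variance (blockEnergyLeft P N b) (P.gibbsMeasure N T)

/-- Static Gibbs variance `W_R = Var_{μ_T}(E_{>b})`. [folklore] -/
def blockEnergyRightVar (P : OscillatorChain) (T : ℝ) (N b : ℕ) : ℝ :=
  variance (blockEnergyRight P N b) (P.gibbsMeasure N T)

/-- The right-hand side of the fixed-`N` budget (K_T) as a function of the bond-heat variance `V`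
(entering through `max V 0`; the true variance is `≥ 0`) and the two static variances:
`(V⁺ + √(2V⁺(W_L+W_R)))/(2T²) + √(W_L(2V⁺ + 4(W_L+W_R)))/T²`. [folklore] -/
def contactBudgetBound (T V WL WR : ℝ) : ℝ :=
  (max V 0 + Real.sqrt (2 * max V 0 * (WL + WR))) / (2 * T ^ 2) +
    Real.sqrt (WL * (2 * max V 0 + 4 * (WL + WR))) / T ^ 2

/-! ### The three pieces -/

/-- **(K_T) Transient contact budget at fixed `N`** — tag WEAKER(evidence)·ATTACKABLE.  For
`P = pinnedChain ω₂ lam β γ` (all `> 0`), `T > 0`, every `N`, every bond `b` (`b + 1 < N`) and every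
`τ > 0`: `q_L^N(τ) ≤ contactBudgetBound T V_N(b,τ) W_L W_R`.  Proof route (fixed `N`, finite time,
equilibrium path law + drift Girsanov, all landed for `(★)`): (FR) for `Q_b([0,τ])` and for
`E_{≤b}(x_τ) − E_{≤b}(x_0)`, the drift part of `Cov(·, Q^avg)` vanishing by `Θ~`-invariance,
energy balance `q_L = q_b + e_{≤b}`, and Cauchy–Schwarz: `Cov(Q_b, Q^avg) ≤ V + √(2V(W_L+W_R))`,
`Cov(ΔE_{≤b}, Q^avg) ≤ √(4W_L(2V + 4(W_L+W_R)))`.  Strictly weaker than the waypoint: `D_N` does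
not occur, nothing is `N`-uniform, true in the harmonic chain.  Why it might fail as typed: only
through a slip in the constants of `contactHeatResponse` (checked: slope `γ/2` at `τ = 0` is the
contact-limited flux; `T²C^g_N(0) = γ²`). [route statement · this cell; NOT a literature fact] -/
def TransientContactBudgetFixedN : Prop :=
  ∀ ω₂ lam β γ : ℝ, 0 < ω₂ → 0 < lam → 0 < β → 0 < γ → ∀ T : ℝ, 0 < T →
    ∀ N b : ℕ, b + 1 < N → ∀ τ : ℝ, 0 < τ →
      contactHeatResponse (pinnedChain ω₂ lam β γ) T N τ ≤
        contactBudgetBound T (gibbsBondHeatVar (pinnedChain ω₂ lam β γ) T N b τ)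
          (blockEnergyLeftVar (pinnedChain ω₂ lam β γ) T N b)
          (blockEnergyRightVar (pinnedChain ω₂ lam β γ) T N b)

/-- **(W) Extensive static block-energy variances** — tag WEAKER(evidence)·ATTACKABLE.  For
`P = pinnedChain ω₂ lam β γ` (all `> 0`) and `T > 0` there is `C` with, for every `N` and every bond
`b` (`b + 1 < N`): `E_{≤b}, E_{>b} ∈ L²(μ_T)` and `Var_{μ_T}(E_{≤b}), Var_{μ_T}(E_{>b}) ≤ C·N`.
An equilibrium STATICS statement (momenta i.i.d. Gaussian; positions a uniformly log-concave Gibbs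
field, `U'' ≥ ω₂ > 0`, `V'' ≥ 1`: Brascamp–Lieb `Var(F) ≤ T·E|∇_q F|²/ω₂` with `|∇E_{≤b}|² = O(b)`
terms of bounded moments, or exponential decay of correlations of the 1D transfer operator).  True
for harmonic chains (summit false there) — strictly weaker. [route statement · this cell; NOT a literature fact] -/
def ExtensiveBlockEnergyVariance : Prop :=
  ∀ ω₂ lam β γ : ℝ, 0 < ω₂ → 0 < lam → 0 < β → 0 < γ → ∀ T : ℝ, 0 < T →
    ∃ C : ℝ, ∀ N b : ℕ, b + 1 < N →
      MemLp (blockEnergyLeft (pinnedChain ω₂ lam β γ) N b) 2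
          ((pinnedChain ω₂ lam β γ).gibbsMeasure N T) ∧
        MemLp (blockEnergyRight (pinnedChain ω₂ lam β γ) N b) 2
          ((pinnedChain ω₂ lam β γ).gibbsMeasure N T) ∧
        blockEnergyLeftVar (pinnedChain ω₂ lam β γ) T N b ≤ C * N ∧
        blockEnergyRightVar (pinnedChain ω₂ lam β γ) T N b ≤ C * N

/-- **(P) Transient contact surplus** — tag UNDECIDED(stated test)·INSTRUMENTABLE; the `N`-uniform
transport input of the node and the only piece in which the response coefficients occur.  With the
prefix of `BoundedResponse`, for every `c > 0` there is `C` with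
`c N² · D_N ≤ (N − 1)(q_L^N(cN²) + C·N)` for `N ≥ 2`, i.e. with `G_N = D_N/(N−1)`:
`cN²·G_N ≤ q_L^N(cN²) + C·N` — during the transient `[0, cN²]` from the Gibbs start the hot contact
injects, at linear order, at least the steady throughput minus `O(N)δ`
(`∫_0^{cN²} (J_L(s) − J_δ) ds ≥ −C N δ`; `⟺ ∫_0^∞ min(u, cN²) C^g_N(u) du ≥ −C N/T²`).  Implied
by `BoundedResponse` (because `q_L ≥ 0`), one-sided, first moment; expected to hold in the
ballistic harmonic chain (exact Gaussian `q_L`, `G_N`), where the summit fails; anharmonic test =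
MEAN injected heat after a bath quench (MD).  Why it might fail: a super-extensive undershoot of
the contact flux below its steady value before the Thouless time (coherent echoes in a weakly
anharmonic regime); pointwise `C^g_N ≥ 0` is FALSE (underdamped oscillation at `N = 2`) — only the
integrated form is claimed. [route statement · this cell; NOT a literature fact] -/
def TransientContactSurplus : Prop :=
  ∀ ω₂ lam β γ : ℝ, 0 < ω₂ → 0 < lam → 0 < β → 0 < γ →
    ∀ μ : (N : ℕ) → ℝ → ℝ → Measure (PhaseSpace N),
      (∀ (N : ℕ) (T_L T_R : ℝ), 0 < T_L → 0 < T_R →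
        (pinnedChain ω₂ lam β γ).IsSteadyState N T_L T_R (μ N T_L T_R)) →
      ∀ T : ℝ, 0 < T → ∀ D : ℕ → ℝ,
        (∀ N : ℕ, Tendsto (fun δ : ℝ =>
            (pinnedChain ω₂ lam β γ).totalCurrent (μ N (T + δ / 2) (T - δ / 2)) / δ)
          (nhdsWithin 0 {(0 : ℝ)}ᶜ) (nhds (D N))) →
        ∀ c : ℝ, 0 < c → ∃ C : ℝ, ∀ N : ℕ, 2 ≤ N →
          c * (N : ℝ) ^ 2 * D N ≤
            ((N : ℝ) - 1) *
              (contactHeatResponse (pinnedChain ω₂ lam β γ) T N (c * (N : ℝ) ^ 2) + C * N)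

/-! ### Real arithmetic of the transfer -/

/-- The budget is at most linear in `N` once `V ≤ A'·s·N` and `0 ≤ W_L, W_R ≤ C'·N`
(`A', C', s ≥ 0`): `contactBudgetBound T V W_L W_R ≤ κ·N` with
`κ = (A's + √(4A'sC'))/(2T²) + √(C'(2A's + 8C'))/T²`. [folklore] -/
theorem contactBudgetBound_le_linear {T V WL WR A' C' s N : ℝ} (hT : 0 < T) (hA' : 0 ≤ A')
    (hC' : 0 ≤ C') (hs : 0 ≤ s) (hN : 0 ≤ N) (hV : V ≤ A' * s * N) (hWL0 : 0 ≤ WL)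
    (hWR0 : 0 ≤ WR) (hWL : WL ≤ C' * N) (hWR : WR ≤ C' * N) :
    contactBudgetBound T V WL WR ≤
      ((A' * s + Real.sqrt (4 * A' * s * C')) / (2 * T ^ 2) +
        Real.sqrt (C' * (2 * A' * s + 8 * C')) / T ^ 2) * N := by
  have hV0 : 0 ≤ max V 0 := le_max_right _ _
  have hVb : max V 0 ≤ A' * s * N := max_le hV (by positivity)
  -- first square root
  have h1 : 2 * max V 0 * (WL + WR) ≤ (4 * A' * s * C') * N ^ 2 := by
    have hm : max V 0 * (WL + WR) ≤ (A' * s * N) * (C' * N + C' * N) :=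
      mul_le_mul hVb (add_le_add hWL hWR) (by positivity) (by positivity)
    nlinarith [hm]
  have hsq1 : Real.sqrt (2 * max V 0 * (WL + WR)) ≤ Real.sqrt (4 * A' * s * C') * N := by
    calc Real.sqrt (2 * max V 0 * (WL + WR))
        ≤ Real.sqrt ((4 * A' * s * C') * N ^ 2) := Real.sqrt_le_sqrt h1
      _ = Real.sqrt (4 * A' * s * C') * N := by
          rw [Real.sqrt_mul (by positivity), Real.sqrt_sq hN]
  -- second square root
  have h2 : WL * (2 * max V 0 + 4 * (WL + WR)) ≤ (C' * (2 * A' * s + 8 * C')) * N ^ 2 := by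
    have hin : 2 * max V 0 + 4 * (WL + WR) ≤ (2 * A' * s + 8 * C') * N := by nlinarith
    have hm : WL * (2 * max V 0 + 4 * (WL + WR)) ≤ (C' * N) * ((2 * A' * s + 8 * C') * N) :=
      mul_le_mul hWL hin (by positivity) (by positivity)
    nlinarith [hm]
  have hsq2 : Real.sqrt (WL * (2 * max V 0 + 4 * (WL + WR))) ≤
      Real.sqrt (C' * (2 * A' * s + 8 * C')) * N := by
    calc Real.sqrt (WL * (2 * max V 0 + 4 * (WL + WR)))
        ≤ Real.sqrt ((C' * (2 * A' * s + 8 * C')) * N ^ 2) := Real.sqrt_le_sqrt h2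
      _ = Real.sqrt (C' * (2 * A' * s + 8 * C')) * N := by
          rw [Real.sqrt_mul (by positivity), Real.sqrt_sq hN]
  -- assemble
  have ha : (max V 0 + Real.sqrt (2 * max V 0 * (WL + WR))) / (2 * T ^ 2) ≤
      (A' * s * N + Real.sqrt (4 * A' * s * C') * N) / (2 * T ^ 2) :=
    div_le_div_of_nonneg_right (add_le_add hVb hsq1) (by positivity)
  have hb : Real.sqrt (WL * (2 * max V 0 + 4 * (WL + WR))) / T ^ 2 ≤
      Real.sqrt (C' * (2 * A' * s + 8 * C')) * N / T ^ 2 :=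
    div_le_div_of_nonneg_right hsq2 (by positivity)
  have e : ((A' * s + Real.sqrt (4 * A' * s * C')) / (2 * T ^ 2) +
        Real.sqrt (C' * (2 * A' * s + 8 * C')) / T ^ 2) * N =
      (A' * s * N + Real.sqrt (4 * A' * s * C') * N) / (2 * T ^ 2) +
        Real.sqrt (C' * (2 * A' * s + 8 * C')) * N / T ^ 2 := by ring
  rw [e]
  exact add_le_add ha hb

/-- **Abstract transfer arithmetic of the node.** For response coefficients `D`, an abstract
bond-heat variance `V`, transient contact heat `qL` and static variances `WL, WR`: if `(S)` beyond
`N₀` some bond `b` has `V N b t ≤ A√t` on `1 ≤ t ≤ cN²`; (W) `0 ≤ WL, WR ≤ C_W·N` at every bond;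
(K_T) `qL N τ ≤ contactBudgetBound T (V N b τ) (WL N b) (WR N b)` at every bond and `τ > 0`; (P)
`c N² D_N ≤ (N−1)(qL N (cN²) + C N)` for `N ≥ 2`; and `0 ≤ D_N` for `N ≥ 2` — then `N ↦ |D_N|` is
bounded, explicitly by `(κ + max C 0)/c` beyond `max(N₀, 2, ⌈1/c⌉₊)`, `κ` the slope of
`contactBudgetBound_le_linear` at `A' = max A 0`, `C' = max C_W 0`, `s = √c`. [folklore] -/
theorem bddAbove_abs_of_transientContact {D : ℕ → ℝ} {V : ℕ → ℕ → ℝ → ℝ} {qL : ℕ → ℝ → ℝ}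
    {WL WR : ℕ → ℕ → ℝ} {A c C C_W T : ℝ} {N₀ : ℕ} (hc : 0 < c) (hT : 0 < T)
    (hS : ∀ N : ℕ, N₀ ≤ N → ∃ b : ℕ, b + 1 < N ∧
      ∀ t : ℝ, 1 ≤ t → t ≤ c * (N : ℝ) ^ 2 → V N b t ≤ A * Real.sqrt t)
    (hW : ∀ N b : ℕ, b + 1 < N → 0 ≤ WL N b ∧ 0 ≤ WR N b ∧ WL N b ≤ C_W * N ∧ WR N b ≤ C_W * N)
    (hK : ∀ N b : ℕ, b + 1 < N → ∀ τ : ℝ, 0 < τ →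
      qL N τ ≤ contactBudgetBound T (V N b τ) (WL N b) (WR N b))
    (hP : ∀ N : ℕ, 2 ≤ N →
      c * (N : ℝ) ^ 2 * D N ≤ ((N : ℝ) - 1) * (qL N (c * (N : ℝ) ^ 2) + C * N))
    (hD0 : ∀ N : ℕ, 2 ≤ N → 0 ≤ D N) :
    BddAbove (Set.range fun N => |D N|) := by
  -- constants
  set A' : ℝ := max A 0 with hA'
  set C' : ℝ := max C 0 with hC'
  set C_W' : ℝ := max C_W 0 with hC_W'
  have hA'0 : 0 ≤ A' := le_max_right _ _
  have hC'0 : 0 ≤ C' := le_max_right _ _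
  have hC_W'0 : 0 ≤ C_W' := le_max_right _ _
  set s : ℝ := Real.sqrt c with hs
  have hs0 : 0 ≤ s := Real.sqrt_nonneg _
  set κ : ℝ := (A' * s + Real.sqrt (4 * A' * s * C_W')) / (2 * T ^ 2) +
    Real.sqrt (C_W' * (2 * A' * s + 8 * C_W')) / T ^ 2 with hκ
  have hκ0 : 0 ≤ κ := by positivity
  set B : ℝ := (κ + C') / c with hB
  set M : ℕ := max (max N₀ 2) ⌈1 / c⌉₊ with hM
  -- the eventual bound
  have hbound : ∀ N : ℕ, M ≤ N → |D N| ≤ B := by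
    intro N hN
    have hN₀ : N₀ ≤ N := le_trans (le_trans (le_max_left _ _) (le_max_left _ _)) hN
    have hN2 : 2 ≤ N := le_trans (le_trans (le_max_right _ _) (le_max_left _ _)) hN
    have hNc : ⌈1 / c⌉₊ ≤ N := le_trans (le_max_right _ _) hN
    have hN2r : (2 : ℝ) ≤ N := by exact_mod_cast hN2
    have hNpos : (0 : ℝ) < N := by linarith
    have hcN : 1 ≤ c * (N : ℝ) := by
      have h1 : 1 / c ≤ (N : ℝ) := Nat.ceil_le.mp hNc
      rw [div_le_iff₀ hc] at h1
      linarith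
    -- the Thouless time
    set t : ℝ := c * (N : ℝ) ^ 2 with ht
    have ht1 : 1 ≤ t := by
      have : c * (N : ℝ) ≤ c * (N : ℝ) ^ 2 := by nlinarith
      linarith
    have htpos : 0 < t := lt_of_lt_of_le zero_lt_one ht1
    have hsqrt : Real.sqrt t = s * (N : ℝ) := by
      rw [ht, Real.sqrt_mul hc.le, Real.sqrt_sq hNpos.le]
    -- the bond of (S) and its variance bound at the Thouless time
    obtain ⟨b, hb, hV⟩ := hS N hN₀
    have hVt : V N b t ≤ A' * s * N := by
      have h1 : V N b t ≤ A * (s * N) := by rw [← hsqrt]; exact hV t ht1 le_rfl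
      calc V N b t ≤ A * (s * N) := h1
        _ ≤ A' * (s * N) := mul_le_mul_of_nonneg_right (le_max_left _ _) (by positivity)
        _ = A' * s * N := by ring
    -- static variances at that bond
    obtain ⟨hWL0, hWR0, hWL, hWR⟩ := hW N b hb
    have hWL' : WL N b ≤ C_W' * N :=
      hWL.trans (mul_le_mul_of_nonneg_right (le_max_left _ _) hNpos.le)
    have hWR' : WR N b ≤ C_W' * N :=
      hWR.trans (mul_le_mul_of_nonneg_right (le_max_left _ _) hNpos.le)
    -- (K_T): the transient contact heat is O(N)
    have hq : qL N t ≤ κ * N :=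
      (hK N b hb t htpos).trans
        (contactBudgetBound_le_linear hT hA'0 hC_W'0 hs0 hNpos.le hVt hWL0 hWR0 hWL' hWR')
    -- (P): c N² D_N ≤ (N - 1)(qL + C N) ≤ N (κ + C') N
    have hPN : t * D N ≤ ((N : ℝ) - 1) * (qL N t + C * N) := hP N hN2
    have hCN : C * (N : ℝ) ≤ C' * N := mul_le_mul_of_nonneg_right (le_max_left _ _) hNpos.le
    have hq' : qL N t + C * N ≤ (κ + C') * N := by linarith
    have hNm1 : (0 : ℝ) ≤ (N : ℝ) - 1 := by linarith
    have h3 : t * D N ≤ ((N : ℝ) - 1) * ((κ + C') * N) :=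
      hPN.trans (mul_le_mul_of_nonneg_left hq' hNm1)
    have h4 : ((N : ℝ) - 1) * ((κ + C') * N) ≤ (N : ℝ) * ((κ + C') * N) :=
      mul_le_mul_of_nonneg_right (by linarith) (by positivity)
    have h5 : (N : ℝ) ^ 2 * (D N * c) ≤ (N : ℝ) ^ 2 * (κ + C') := by
      have e1 : (N : ℝ) ^ 2 * (D N * c) = t * D N := by rw [ht]; ring
      have e2 : (N : ℝ) ^ 2 * (κ + C') = (N : ℝ) * ((κ + C') * N) := by ring
      rw [e1, e2]
      exact h3.trans h4
    have hDc : D N * c ≤ κ + C' := le_of_mul_le_mul_left h5 (by positivity)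
    have hDB : D N ≤ B := by rw [hB, le_div_iff₀ hc]; exact hDc
    rw [abs_of_nonneg (hD0 N hN2)]
    exact hDB
  -- finitely many small N are absorbed
  have hbu : IsBoundedUnder (· ≤ ·) atTop fun N => |D N| := ⟨B, eventually_atTop.2 ⟨M, hbound⟩⟩
  exact hbu.bddAbove_range

/-! ### The junction -/

/-- **`BoundedResponse` from the transient contact budget.**  (K_T) the fixed-`N` budget, (W) the
static block-energy variances, (P) the transient contact surplus, `(S)` the √t bond-heat variance
up to the Thouless time (`SubdiffusiveBondHeat`, by name), and the two PROVED items `(★)`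
`LinearResponseFTUR` (only its clause `0 ≤ D_N`) and `NessUnique` (feeding `(★)`) give bounded
response along every steady-state family of `pinnedChain ω₂ lam β γ`.  The item
`ExtensiveSnapshotIrreversibility` (stmt-9121) does not occur.  `(S)`'s `let V` is this file's
`gibbsBondHeatVar` definitionally. [folklore] -/
theorem boundedResponse_of_transientContact (hK : TransientContactBudgetFixedN)
    (hW : ExtensiveBlockEnergyVariance) (hP : TransientContactSurplus) (hS : SubdiffusiveBondHeat)
    (hF : LinearResponseFTUR) (hU : NessUnique) : BoundedResponse := by
  intro ω₂ lam β γ hω hl hβ hγ μ hμ T hT D hD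
  obtain ⟨A, c, hc, N₀, hSN⟩ := hS ω₂ lam β γ hω hl hβ hγ T hT
  obtain ⟨C_W, hWN⟩ := hW ω₂ lam β γ hω hl hβ hγ T hT
  obtain ⟨C, hPN⟩ := hP ω₂ lam β γ hω hl hβ hγ μ hμ T hT D hD c hc
  have hFN := hF ω₂ lam β γ hω hl hβ hγ (hU ω₂ lam β γ hω hl hβ hγ) μ hμ T hT D hD
  have hS' : ∀ N : ℕ, N₀ ≤ N → ∃ b : ℕ, b + 1 < N ∧ ∀ t : ℝ, 1 ≤ t → t ≤ c * (N : ℝ) ^ 2 →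
      gibbsBondHeatVar (pinnedChain ω₂ lam β γ) T N b t ≤ A * Real.sqrt t := hSN
  have hD0 : ∀ N : ℕ, 2 ≤ N → 0 ≤ D N := fun N hN => (hFN N hN).1
  have hW' : ∀ N b : ℕ, b + 1 < N →
      0 ≤ blockEnergyLeftVar (pinnedChain ω₂ lam β γ) T N b ∧
      0 ≤ blockEnergyRightVar (pinnedChain ω₂ lam β γ) T N b ∧
      blockEnergyLeftVar (pinnedChain ω₂ lam β γ) T N b ≤ C_W * N ∧
      blockEnergyRightVar (pinnedChain ω₂ lam β γ) T N b ≤ C_W * N := by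
    intro N b hb
    obtain ⟨-, -, h3, h4⟩ := hWN N b hb
    exact ⟨variance_nonneg _ _, variance_nonneg _ _, h3, h4⟩
  exact bddAbove_abs_of_transientContact hc hT hS' hW' (hK ω₂ lam β γ hω hl hβ hγ T hT) hPN hD0

/-- **`BoundedResponse` ⟸ K_T ∧ W ∧ P ∧ (S)**, the two PROVED route items discharged by their
landed proofs (`LinearResponseFTUR_proof`; `nessUnique_proof`, stated on the shared decl of route
`EmbeddedDrudeMourre`, definitionally this route's `NessUnique`). [folklore] -/
theorem boundedResponse_of_transientContact' (hK : TransientContactBudgetFixedN)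
    (hW : ExtensiveBlockEnergyVariance) (hP : TransientContactSurplus)
    (hS : SubdiffusiveBondHeat) : BoundedResponse :=
  boundedResponse_of_transientContact hK hW hP hS
    Summit.AtomisticToContinuum.FouriersLaw.Theorems.LinearResponseFTUR_proof
    Summit.AtomisticToContinuum.FouriersLaw.Theorems.nessUnique_proof

end

end Summit.AtomisticToContinuum.FouriersLaw.Theorems.BoundedResponse.TransientContact
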